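import Summits.MatrixMultiplication.OmegaCensus.ThreeSetLineModFourSliceExcSound
import Summits.MatrixMultiplication.OmegaCensus.ThreeSetLineModFourSliceTailSound
import HarnessLib

/-!
# `(4,7,10)@841`: killer `1` (`[26, 27, 28, 28]`) — block file `13` (3 blocks, ≈ 30 s of kernel time)

ω-census `pub-omega`, family (b3), seat pub-omega-group gen 42.  Framing: lottery ticket; floor = certified bounds/negative ranges.
VALUE: part of the finite half of the kernel route for the census cell `(4,7,10)@841` (bit-sliced mod-4 filter,
`ThreeSetLineModFourSlice*`; the «100 % kill» of the filter is a completeness datum measured on samples, NOT a correctness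
input: every block is decided by the kernel); NOT progress on ω.
-/

set_option Elab.async false

namespace Summit.MatrixMultiplication.OmegaCensus

namespace Z29M4710

/-- Killer `1`, TAIL block `pre = [1, 0]`, first free entry `≥ 1`, free part `compsLit 27 5` bumped (169911 data): no datum admits the line identity. [folklore] -/
theorem t1_91 : ∀ Fl ∈ (ZpZpDomino.compsLit 27 5).map (fun l => ([1,0] : List ℕ) ++ LineMod.bumpHead 1 l), ∀ (G : ZMod 29 → ℕ) (s : ZMod 29), (∀ u, G u ≤ 10) →
    ¬ ∀ τ : ZMod 29, (∑ u : ZMod 29, lineMat3 (vecFn [0,0,0,0,0,0,0,0,0,0,0,0,0,0,0,0,0,0,0,0,0,0,0,0,0,0,1,1,2]) (vecFn Fl) τ u * G u) + (if s = τ then 1 else 0) = 29 :=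
  LineMod.blockChkT_sound (by decide +kernel : LineMod.blockChkT 29 29 7 10 [0,0,0,0,0,0,0,0,0,0,0,0,0,0,0,0,0,0,0,0,0,0,0,0,0,0,1,1,2] [1,0] 27 5 1 [false, true, false, true, true, false, true] = true)

/-- Killer `1`, TAIL block `pre = [1]`, first free entry `≥ 1`, free part `compsLit 28 5` bumped (201376 data): no datum admits the line identity. [folklore] -/
theorem t1_92 : ∀ Fl ∈ (ZpZpDomino.compsLit 28 5).map (fun l => ([1] : List ℕ) ++ LineMod.bumpHead 1 l), ∀ (G : ZMod 29 → ℕ) (s : ZMod 29), (∀ u, G u ≤ 10) →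
    ¬ ∀ τ : ZMod 29, (∑ u : ZMod 29, lineMat3 (vecFn [0,0,0,0,0,0,0,0,0,0,0,0,0,0,0,0,0,0,0,0,0,0,0,0,0,0,1,1,2]) (vecFn Fl) τ u * G u) + (if s = τ then 1 else 0) = 29 :=
  LineMod.blockChkT_sound (by decide +kernel : LineMod.blockChkT 29 29 7 10 [0,0,0,0,0,0,0,0,0,0,0,0,0,0,0,0,0,0,0,0,0,0,0,0,0,0,1,1,2] [1] 28 5 1 [false, true, false, true, true, false, true] = true)

/-- Killer `1`, TAIL block `pre = []`, first free entry `≥ 2`, free part `compsLit 29 5` bumped (237336 data): no datum admits the line identity. [folklore] -/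
theorem t1_93 : ∀ Fl ∈ (ZpZpDomino.compsLit 29 5).map (fun l => ([] : List ℕ) ++ LineMod.bumpHead 2 l), ∀ (G : ZMod 29 → ℕ) (s : ZMod 29), (∀ u, G u ≤ 10) →
    ¬ ∀ τ : ZMod 29, (∑ u : ZMod 29, lineMat3 (vecFn [0,0,0,0,0,0,0,0,0,0,0,0,0,0,0,0,0,0,0,0,0,0,0,0,0,0,1,1,2]) (vecFn Fl) τ u * G u) + (if s = τ then 1 else 0) = 29 :=
  LineMod.blockChkT_sound (by decide +kernel : LineMod.blockChkT 29 29 7 10 [0,0,0,0,0,0,0,0,0,0,0,0,0,0,0,0,0,0,0,0,0,0,0,0,0,0,1,1,2] [] 29 5 2 [false, true, false, true, true, false, true] = true)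

end Z29M4710

end Summit.MatrixMultiplication.OmegaCensus
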